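import Literature.NumberTheory.DiophantineGeometry.GeneralizedFermatTwoPowerCoefficientFreyProofs
import Literature.NumberTheory.Automorphic.CDTTheorem722SerreProofs
import Literature.NumberTheory.EllipticCurves.ModularCurveGenusBoundProofs
import HarnessLib

/-!
# Ribet 1997, Theorem 3 along Serre's road: `ribet1997_twoPowerFermat` from Khare–Wintenberger
# and the local description of `E[p]` (proofs)

Topic `Literature/NumberTheory/DiophantineGeometry`; second sibling *proofs* file (theorems only:
no definition, no named fact, no `sorry`) of `GeneralizedFermatTwoPowerCoefficient`, next to
`GeneralizedFermatTwoPowerCoefficientFreyProofs` (the arithmetic of the Frey curve of a normalised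
solution, Ribet 1997 §2).  The named fact `ribet1997_twoPowerFermat` is K. Ribet, *On the equation
`a^p + 2^α b^p + c^p = 0`*, Acta Arith. 79 (1997), Thm. 3, first sentence, `2 ≤ α < p`, `p ≥ 5`.

## What is proved

* Part A — the last sentence of Ribet's proof (§3, p. 13: *"there are no non-zero cusp forms of
  weight two on `Γ₀(8)`"*): `cuspForm_gamma0_eq_zero_of_dvd_eight` (`S₂(Γ₀(N)) = 0` for `N ∣ 8`,
  from the tree's Manin bound `finrank_cuspForm_two_le_genusX0` and `g(X₀(N)) = 0`),
  `not_isNewform0_of_dvd_eight`; and the `Γ₁ → Γ₀` bookkeeping for a prime `p ∤ φ(N)`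
  (`nebentypus_apply_eq_one_of_map_coeff_zero_eq_of_not_dvd_totient`, the tree's
  `CDTTheorem722SerreProofs` lemma with `N < p` weakened to `p ∤ φ(N)`).
* Part B — primes of the conductor of a Frey curve: an odd prime of `N_E` divides `AB(A+B)`
  (`dvd_of_dvd_conductorNorm_freyCurve`), and `ord₂ N_E ≤ 1` when `16 ∣ B`
  (`factorization_conductorNorm_freyCurve_two_le_one`; Ribet §2, `t ∈ {0, 1}`).
* Part C — **`ribet1997_twoPowerFermat_of_khare_wintenberger_of_frey_local`**: the named fact
  from the tree's named fact `Automorphic.khare_wintenberger` (Serre's conjecture (3.2.4),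
  Khare–Wintenberger 2009) and five local statements about the mod-`p` representation of Frey
  curves / elliptic curves semistable at a prime, each a printed statement of Ribet 1997 §2 or
  Serre 1987 §4.1 taken as a hypothesis (see the theorem's docstring): irreducibility (Ribet
  Prop. 1; Serre Prop. 6), weight `2` (Serre (4.1.11)), `N(ρ̄) ∣ N_E` (Serre (4.6.3)), Tate's
  unramifiedness criterion (Serre (4.1.12)) and the Diamond–Kramer exponent `f₂ ≤ 3` for
  `ord₂ (B) ∈ {2, 3}`.  This is Serre's road (Duke Math. J. 54 (1987), §4.2, proof of Thm. 1) run
  for Ribet's equation; it replaces Ribet's "`E` modular + level-lowering" (Thm. 5 and [18]).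

So after this file the discharge `ribet1997_twoPowerFermat_holds` is EXACTLY the conjunction of
`khare_wintenberger_holds` (SIZE XL, not in the tree) and the five local statements (each the
subject of a separate literature fact: Mazur's theorem for Frey curves, Serre's weight recipe for
`E[p]`, Carayol's `N(ρ̄) ∣ N_E`, the Tate-curve criterion, Tate's algorithm at `2` for
`y² = x (x − A) (x + B)` with `4 ∥ B` or `8 ∥ B`).

## References

* [Ribet1997] K. A. Ribet, Acta Arith. 79 (1997), 7–16: §2 (Prop. 1, Lemma, Corollary), §3
  (proof of Thm. 3, p. 13).
* [Serre1987] J.-P. Serre, Duke Math. J. 54 (1987): §2.8 Prop. 4, §2.9 Prop. 5, §3.3, §4.1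
  (Prop. 6, (4.1.10)–(4.1.13)), §4.2 (Thm. 1 and its proof), §4.6 ((4.6.3)).
* [KhareWintenberger2009] C. Khare, J.-P. Wintenberger, Invent. Math. 178 (2009), Thm. 1.2,
  Thm. 9.1.
* [DiamondKramer1995] F. Diamond, K. Kramer, Math. Res. Lett. 2 (1995), 299–304.
* F. Diamond, J. Shurman, *A First Course in Modular Forms* (2005), Thm. 3.5.1, §4.3 (used
  through the tree's `ModularCurveGenusBoundProofs`, `CDTTheorem722SerreProofs`).
-/

noncomputable section

open scoped MatrixGroups ModularForm NumberField
open CongruenceSubgroup UpperHalfPlane Polynomial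

namespace Literature.NumberTheory.DiophantineGeometry

open WeierstrassCurve GaloisRepresentations EllipticCurves EllipticCurves.ModularForms
  Rat.HeightOneSpectrum IsDedekindDomain IsDedekindDomain.HeightOneSpectrum
  Literature.NumberTheory.Automorphic Literature.NumberTheory.Automorphic.BCDT

/-! ## Part A. No newforms of weight `2` and level dividing `8` (Ribet 1997, §3, p. 13: "there
are no non-zero cusp forms of weight two on `Γ₀(8)`") -/

/-- The divisors of `8`. [folklore] -/
theorem eq_of_dvd_eight {N : ℕ} (hN : N ∣ 8) : N = 1 ∨ N = 2 ∨ N = 4 ∨ N = 8 := by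
  have h : N ∈ Nat.divisors 8 := Nat.mem_divisors.mpr ⟨hN, by norm_num⟩
  have : Nat.divisors 8 = {1, 2, 4, 8} := by decide
  rw [this] at h
  simpa using h

/-- **`S₂(Γ₀(N)) = 0` for `N ∣ 8`** (Ribet 1997, §3, p. 13: "there are no non-zero cusp forms of
weight two on `Γ₀(8)`"): the modular curves `X₀(1), X₀(2), X₀(4), X₀(8)` have genus `0`, and
`dim S₂(Γ₀(N)) ≤ g(X₀(N))` is the tree's `finrank_cuspForm_two_le_genusX0` (Manin's modular
symbols), packaged for the genus-zero levels as `finrank_cuspForm_two_eq_genusX0_of_mem'`.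
[cite: Ribet1997, §3, p. 13] -/
theorem cuspForm_gamma0_eq_zero_of_dvd_eight {N : ℕ} [NeZero N] (hN : N ∣ 8)
    (g : CuspForm (Gamma0 N) 2) : g = 0 := by
  have hmem : N ∈ ({1, 2, 3, 4, 5, 6, 7, 8, 9, 10, 12, 13, 16, 18, 25} : Finset ℕ) := by
    rcases eq_of_dvd_eight hN with rfl | rfl | rfl | rfl <;> decide
  have hfin : Module.finrank ℂ (CuspForm (Gamma0 N) 2) = genusX0 N :=
    finrank_cuspForm_two_eq_genusX0_of_mem' hmem
  have hg0 : genusX0 N = 0 := by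
    rcases eq_of_dvd_eight hN with rfl | rfl | rfl | rfl
    · obtain ⟨hμ, hν, h₂, h₃⟩ := gamma0_data_1; rw [genusX0, hμ, hν, h₂, h₃]
    · obtain ⟨hμ, hν, h₂, h₃⟩ := gamma0_data_2; rw [genusX0, hμ, hν, h₂, h₃]
    · obtain ⟨hμ, hν, h₂, h₃⟩ := gamma0_data_4; rw [genusX0, hμ, hν, h₂, h₃]
    · obtain ⟨hμ, hν, h₂, h₃⟩ := gamma0_data_8; rw [genusX0, hμ, hν, h₂, h₃]
  rw [hg0] at hfin
  exact (finrank_zero_iff_forall_zero.mp hfin) g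

/-- **No newform of weight `2` on `Γ₀(N)`, `N ∣ 8`.** [cite: Ribet1997, §3, p. 13] -/
theorem not_isNewform0_of_dvd_eight {N : ℕ} [NeZero N] (hN : N ∣ 8) (g : CuspForm (Gamma0 N) 2) :
    ¬ IsNewform0 g :=
  fun hg ↦ hg.ne_zero (cuspForm_gamma0_eq_zero_of_dvd_eight hN g)

section NewformSide

variable {N : ℕ} [NeZero N] {f : CuspForm (Gamma1 N) 2}

/-- **The nebentypus is trivial at `q` as soon as `ε(q) q ≡ q` modulo a prime `p ∤ φ(N)`.**
Variant of the tree's `nebentypus_apply_eq_one_of_map_coeff_zero_eq` (`CDTTheorem722SerreProofs`,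
Serre 1987 n° 3.3 "`ε = 1`"), with its hypothesis `N < p` weakened to `p ∤ φ(N)` (all that the
proof uses: `ε(q)` is a root of unity of order dividing `φ(N)`, and such roots of unity reduce
injectively modulo `p`).  For `N ∣ 8` and `p ≥ 5` this applies since `φ(N) ∣ 4`.
[cite: Serre1987, §3.3 and §4.6] -/
theorem nebentypus_apply_eq_one_of_map_coeff_zero_eq_of_not_dvd_totient {q : ℕ}
    (hq : q.Prime) (hqN : ¬ q ∣ N) {P : Polynomial (coeffCharIntegers f)}
    (hP : P.map (algebraMap (coeffCharIntegers f) (coeffCharField f)) = heckePolynomial f q)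
    {K : Type*} [Field K] {p : ℕ} [Fact p.Prime] [CharP K p] (ι : coeffCharIntegers f →+* K)
    (hqp : q ≠ p) (hpN : ¬ p ∣ Nat.totient N) (h0 : ι (P.coeff 0) = (q : K)) :
    nebentypus f (q : ZMod N) = 1 := by
  have hp : p.Prime := Fact.out
  set e := (algebraMap (coeffCharField f) ℂ).comp
    (algebraMap (coeffCharIntegers f) (coeffCharField f)) with he
  have hinj : Function.Injective e := algebraMap_coeffCharIntegers_complex_injective f
  obtain ⟨u, hu⟩ := (ZMod.isUnit_prime_iff_not_dvd hq).mpr hqN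
  set ζ : ℂ := (nebentypus f (q : ZMod N) : ℂ) with hζ
  have hζpow : ζ ^ Nat.totient N = 1 := by
    rw [hζ, ← hu, ← map_pow, ← Units.val_pow_eq_pow_val, ZMod.pow_totient, Units.val_one,
      map_one]
  have hζint : IsIntegral ℤ (⟨ζ, nebentypus_mem_coeffCharField f q⟩ : coeffCharField f) := by
    rw [isIntegral_coeffCharField_iff]
    exact isIntegral_dirichletCharacter_apply _ _
  set Z : coeffCharIntegers f := ⟨⟨ζ, nebentypus_mem_coeffCharField f q⟩, hζint⟩ with hZ
  have heZ : e Z = ζ := rfl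
  have hZpow : Z ^ Nat.totient N = 1 := hinj (by rw [map_pow, heZ, hζpow, map_one])
  have hP0 : P.coeff 0 = Z * (q : coeffCharIntegers f) := by
    apply hinj
    rw [map_mul, map_natCast, heZ, he, RingHom.comp_apply, (coeff_of_map_eq_heckePolynomial hP).2,
      show ((2 : ℤ) - 1) = 1 from rfl, zpow_one]
  have hqK : (q : K) ≠ 0 := by
    rw [Ne, CharP.cast_eq_zero_iff K p q]
    exact fun h ↦ hqp ((Nat.prime_dvd_prime_iff_eq hp hq).mp h).symm
  have hιZ : ι Z = 1 := by
    have h := h0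
    rw [hP0, map_mul, map_natCast] at h
    exact (mul_eq_right₀ hqK).mp h
  have hZ1 : Z = 1 := eq_one_of_pow_eq_one_of_map_eq_one ι hpN hZpow hιZ
  have h := congrArg e hZ1
  rw [heZ, map_one] at h
  exact_mod_cast h

end NewformSide

/-- `φ(N) ∣ 4` for `N ∣ 8`, so a prime `p ≥ 5` does not divide `φ(N)`. [folklore] -/
theorem not_dvd_totient_of_dvd_eight {N p : ℕ} (hN : N ∣ 8) (h5 : 5 ≤ p) :
    ¬ p ∣ Nat.totient N := by
  intro h
  have hφ : Nat.totient N ∣ 4 := by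
    rcases eq_of_dvd_eight hN with rfl | rfl | rfl | rfl <;> decide
  have := Nat.le_of_dvd (by norm_num) (h.trans hφ)
  omega


/-! ## Part B. The Frey curve of a normalised solution: primes of the conductor -/

section FreySide

variable {A B : ℤ}

/-- An odd prime `q ∤ AB(A+B)` does not divide the conductor of the Frey curve
`y² = x (x − A) (x + B)` (`A, B` coprime, `AB(A+B) ≠ 0`): the integral equation is minimal at `q`
with `q ∤ Δ = 16 (AB(A+B))²`, so `f_q = 0` (Ribet 1997, §2, p. 10: "`N_E` … has the form
`2^t rad′(ABC)`"). [cite: Ribet1997, §2, p. 10] -/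
theorem not_dvd_conductorNorm_freyCurve_of_not_dvd (hAB : IsCoprime A B) (h0 : A * B * (A + B) ≠ 0)
    {q : ℕ} (hq : q.Prime) (hq2 : q ≠ 2) (hqm : ¬ (q : ℤ) ∣ A * B * (A + B)) :
    ¬ q ∣ (freyCurve A B).conductorNorm ℤ := by
  haveI := isElliptic_freyCurve h0
  haveI := isElliptic_freyIntModel h0
  set u : HeightOneSpectrum ℤ := (primesEquiv (R := ℤ)).symm ⟨q, hq⟩ with hu
  have hqu : natGenerator u = q := Literature.NumberTheory.EllipticCurves.Rat.natGenerator_primesEquiv_symm ⟨q, hq⟩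
  have hmin := isMinimalAt_freyIntModel_of_ne_two hAB u (by rw [hqu]; exact hq2)
  have hf0 : ((freyIntModel A B).baseChange ℚ).conductorExponent u = 0 := by
    refine conductorExponent_eq_zero_of_not_dvd_Δ hmin ?_
    rw [hqu, freyIntModel_Δ]
    intro h
    have hqint : Prime (q : ℤ) := Nat.prime_iff_prime_int.mp hq
    rcases hqint.dvd_or_dvd h with h16 | h2
    · exact hq2 (eq_two_of_dvd_sixteen hq h16)
    · exact hqm (hqint.dvd_of_dvd_pow h2)
  rw [baseChange_freyIntModel] at hf0
  have hfac : ((freyCurve A B).conductorNorm ℤ).factorization q = 0 := by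
    rw [show q = ((⟨q, hq⟩ : Nat.Primes) : ℕ) from rfl, factorization_conductorNorm_primesEquiv_symm,
      ← hu, hf0]
  intro hdvd
  have := (Nat.factorization_eq_zero_iff _ _).mp hfac
  rcases this with h | h | h
  · exact h hq
  · exact h hdvd
  · exact (conductorNorm_pos_holds (freyCurve A B)).ne' h

/-- An odd prime of the conductor of the Frey curve divides `AB(A+B)` (`A, B` coprime,
`AB(A+B) ≠ 0`; Ribet 1997, §2, p. 10: `N_E = 2^t rad′(ABC)`). [cite: Ribet1997, §2, p. 10] -/
theorem dvd_of_dvd_conductorNorm_freyCurve (hAB : IsCoprime A B) (h0 : A * B * (A + B) ≠ 0)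
    {q : ℕ} (hq : q.Prime) (hq2 : q ≠ 2) (hdvd : q ∣ (freyCurve A B).conductorNorm ℤ) :
    (q : ℤ) ∣ A * B * (A + B) := by
  by_contra h
  exact not_dvd_conductorNorm_freyCurve_of_not_dvd hAB h0 hq hq2 h hdvd

/-- **`16 ∣ B`: `ord₂ (N_E) ≤ 1`** (`t ∈ {0, 1}`, Ribet 1997, §2, p. 11), from
`N_E ∣ rad (AB(A+B))` (`conductorNorm_freyCurve_dvd_radical_of_sixteen_dvd`).
[cite: Ribet1997, §2, p. 11] -/
theorem factorization_conductorNorm_freyCurve_two_le_one (hAB : IsCoprime A B)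
    (h0 : A * B * (A + B) ≠ 0) (hA : A ≡ -1 [ZMOD 4]) (hB : (16 : ℤ) ∣ B) :
    ((freyCurve A B).conductorNorm ℤ).factorization 2 ≤ 1 := by
  haveI := isElliptic_freyCurve h0
  have hdvd := conductorNorm_freyCurve_dvd_radical_of_sixteen_dvd hAB h0 hA hB
  have hle := (Nat.factorization_le_iff_dvd (conductorNorm_pos_holds (freyCurve A B)).ne'
    UniqueFactorizationMonoid.radical_ne_zero).mpr hdvd
  exact (hle 2).trans (UniqueFactorizationMonoid.squarefree_radical.natFactorization_le_one 2)

end FreySide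

/-! ## Part C. Ribet's Theorem 3 along Serre's road -/

section SerreRoad

open ValuativeRel GaloisRepresentations.ModPGaloisRep GaloisRepresentations.IsNonarchimedeanLocalField

/-- **A natural number with no odd prime factor, dividing a number `M` with `ord₂ (M) ≤ 3`,
divides `8`.** [folklore] -/
theorem dvd_eight_of_forall_prime {N M : ℕ} (hN0 : N ≠ 0) (hNM : N ∣ M) (hM0 : M ≠ 0)
    (hodd : ∀ q : ℕ, q.Prime → q ∣ N → q = 2) (hM : M.factorization 2 ≤ 3) : N ∣ 8 := by
  obtain ⟨e, he⟩ : ∃ e : ℕ, N = 2 ^ e :=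
    ⟨_, Nat.eq_prime_pow_of_unique_prime_dvd hN0 fun {d} hd hdN ↦ hodd d hd hdN⟩
  have h2M : 2 ^ e ∣ M := he ▸ hNM
  have hle : e ≤ M.factorization 2 := (Nat.prime_two.pow_dvd_iff_le_factorization hM0).mp h2M
  rw [he, show (8 : ℕ) = 2 ^ 3 by norm_num]
  exact Nat.pow_dvd_pow 2 (hle.trans hM)

/-- **No newform of weight `2` and level dividing `8` carries `E[p] ⊗ K`, `p ≥ 5`** (the last
two sentences of Ribet's proof, §3, p. 13, in Serre's language).  Let `W/ℚ` be elliptic, `ρ̄` a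
framed model of `E[p]`, `j : 𝔽_p → K` (`K` discrete of characteristic `p`), and suppose
`ρ̄ ⊗ K` is attached (`IsGaloisRepOfNewform1Int`, away from `N p`) to a newform
`f ∈ S₂(Γ₁(N))` with `N ∣ 8` along `ι : 𝓞_f → K`.  At every prime `q > B₀` of good reduction
(`q ≠ p`, `q ∤ N`) the Frobenius polynomial of `E[p]` is `X² − a_q X + q`
(`charpoly_baseChange_of_isTorsionGaloisRep`), so `ι(ε_f(q) q) = q` and `ε_f(q) = 1`
(`p ∤ φ(N) ∣ 4`); by Dirichlet `ε_f = 1`, `f` descends to a newform on `Γ₀(N)`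
(`exists_isNewform0_coe_eq_of_nebentypus_eq_one`), and there is none
(`not_isNewform0_of_dvd_eight`). [cite: Ribet1997, §3, p. 13] [cite: Serre1987, §3.3 and §4.2] -/
theorem false_of_isGaloisRepOfNewform1Int_of_dvd_eight (W : WeierstrassCurve ℚ) [W.IsElliptic]
    {p : ℕ} [Fact p.Prime] (h5 : 5 ≤ p) {ρ : ModPGaloisRep ℚ (ZMod p) 2}
    (hρ : W.IsTorsionGaloisRep p ρ) {K : Type} [Field K] [CharP K p] [TopologicalSpace K]
    [DiscreteTopology K] (j : ZMod p →+* K) {N : ℕ} [NeZero N] (hN8 : N ∣ 8)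
    {f : CuspForm (Gamma1 N) 2} (hf : IsNewform1 f) (ιf : coeffCharIntegers f →+* K)
    (hgal : IsGaloisRepOfNewform1Int f ιf {q | q ∣ N * p}
      (FramedRep.baseChange j continuous_of_discreteTopology ρ))
    (B₀ : ℕ) (hgoodB : ∀ q : ℕ, q.Prime → B₀ < q → ¬ q ∣ W.conductorNorm ℤ) : False := by
  classical
  have hp : p.Prime := Fact.out
  have hε : nebentypus f = 1 := by
    refine nebentypus_eq_one_of_forall_prime (max p B₀) ?_
    intro q hq hqB hqN
    have hqp : q ≠ p := fun h' ↦ (lt_of_le_of_lt (le_max_left _ _) hqB).ne' h'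
    have hqNE : ¬ q ∣ W.conductorNorm ℤ := hgoodB q hq (lt_of_le_of_lt (le_max_right _ _) hqB)
    obtain ⟨v, rfl⟩ : ∃ v : HeightOneSpectrum (𝓞 ℚ), (primesEquiv v : ℕ) = q :=
      ⟨primesEquiv.symm ⟨q, hq⟩, by rw [Equiv.apply_symm_apply]⟩
    have hvS : ((primesEquiv v : Nat.Primes) : ℕ) ∉ {q | q ∣ N * p} := by
      intro h'
      rcases (Nat.Prime.dvd_mul hq).mp h' with h1 | h1
      · exact hqN h1
      · exact hqp ((Nat.prime_dvd_prime_iff_eq hq hp).mp h1)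
    obtain ⟨-, P, hP, hch⟩ := hgal v hvS
    obtain ⟨𝔓, h𝔓⟩ := primesAbove_nonempty v
    obtain ⟨σ, hσ⟩ := exists_isArithFrobAt_of_mem_primesAbove_holds (v := v) h𝔓
    have hgood : W.HasGoodReductionAt v := by
      by_contra h'
      exact hqNE ((W.dvd_conductorNorm_iff v).mpr h')
    have h1 := hch 𝔓 h𝔓 σ hσ
    rw [charpoly_baseChange_of_isTorsionGaloisRep W hρ j _ hqp hgood h𝔓 hσ] at h1
    have h2 := congrArg (fun Q : Polynomial K ↦ Q.coeff 0) h1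
    simp only [Polynomial.coeff_map, coeff_add, coeff_sub, coeff_X_pow, coeff_C_mul,
      coeff_X_zero, coeff_C_zero] at h2
    have h0' : ιf (P.coeff 0) = ((primesEquiv v : ℕ) : K) := by
      rw [← h2]; simp
    exact nebentypus_apply_eq_one_of_map_coeff_zero_eq_of_not_dvd_totient hq hqN hP ιf hqp
      (not_dvd_totient_of_dvd_eight hN8 h5) h0'
  obtain ⟨g, hg, -⟩ := exists_isNewform0_coe_eq_of_nebentypus_eq_one hf hε
  exact not_isNewform0_of_dvd_eight hN8 g hg

/-- **Ribet 1997, Theorem 3 (first sentence, `2 ≤ α < p`, `p ≥ 5`) along Serre's road.**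
Ribet's printed proof (§3, p. 13) runs: `E[p]` is irreducible (Prop. 1); `E` is modular (Thm. 5),
so `ρ = E[p]` is modular of level `N_E = 2^t rad′(ABC)`; `ρ` is finite at each `l ≠ 2`
(`ord_l (Δ_E) ≡ 0 mod p`); Ribet's level-lowering theorem makes `ρ` modular of level `2^t`,
`t ∈ {0, 1, 3}`; and "there are no non-zero cusp forms of weight two on `Γ₀(8)`".  Neither the
Modularity Theorem (the tree's unproved `exists_isNewformOf`) nor level-lowering (not catalogued)
is available; this theorem replaces the pair by **Serre's conjecture (3.2.4)** in the tree's form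
`Automorphic.khare_wintenberger p k` (theorem of Khare–Wintenberger–Kisin, the tree's named fact,
hypothesis `hKW`) — exactly as Serre, Duke Math. J. 54 (1987), §4.2, proves Fermat's Last Theorem
from (3.3.1) for the curves `E_{A,B,C}` of his §4.1 — together with the **local description of
`ρ̄ = E[p] ⊗ 𝔽̄_p`** that Ribet and Serre use, taken as hypotheses (none is in the tree):

* `hirr` — Ribet 1997, Prop. 1 and its Corollary (p. 11–12): `E[p]` is irreducible for `p ≥ 5`
  for the Frey curves `y² = x (x − A) (x + B)`, `A ≡ −1 (mod 4)`, `B` even (semistable case: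
  Serre 1987, §4.1, Prop. 6, via Mazur; additive case: Diamond–Kramer 1995);
* `hwt` — Serre 1987, (4.1.11) with §2.8 Prop. 4 and §2.9 Prop. 5: for `E` semistable at `p ≥ 5`
  with `p ∣ ord_p (Δ_min)`, the Serre weight of `E[p]` is `2`;
* `hlevN` — Serre 1987, (4.6.3) (Carayol): the Serre level `N(ρ̄)` divides `N_E`;
* `hTate` — Serre 1987, (4.1.12): at a prime `l ≠ p` where `E` is semistable and
  `p ∣ ord_l (Δ_min)`, `ρ̄` is unramified, so `l ∤ N(ρ̄)` ("se vérifie immédiatement sur les modèles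
  de Tate");
* `hDK` — Diamond–Kramer 1995 as quoted by Ribet 1997, §2, p. 11: `t = f₂(E) = 3` (here only
  `≤ 3`) when `ord₂ (B) ∈ {2, 3}`, i.e. `4 ∣ B`, `16 ∤ B`.

**Proof** (this file and `GeneralizedFermatTwoPowerCoefficientFreyProofs`).  Normalise a solution
(`ribet1997_twoPowerFermat_iff_normalized`), form `E = freyCurve (a^p) (2^r b^p)` and a framed
model `ρ̄` of `E[p]` (`exists_isTorsionGaloisRep`); `ρ̄ ⊗ 𝔽̄_p` is irreducible (`hirr`, oddness and
Serre's (b′) ⇒ (b), `isAbsolutelyIrreducible_of_hasIrreducibleModPGaloisRep`) and odd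
(`det ρ̄ = χ̄_p`, proved in the tree).  By `hKW` it arises from a newform
`f ∈ S_{k(ρ̄)}(Γ₁(N(ρ̄)))`; `k(ρ̄) = 2` by `hwt` (`p ∣ ord_p (Δ_E)`,
`Ribet1997.dvd_ordMinimalDiscriminant_of_ne_two`).  Every odd prime `l ∣ N(ρ̄)` divides `N_E`
(`hlevN`), hence `AB(A+B)` (`dvd_of_dvd_conductorNorm_freyCurve`), hence is excluded by `hTate`
(`p ∣ ord_l (Δ_E)`); and `ord₂ N(ρ̄) ≤ ord₂ N_E ≤ 3` (`16 ∣ B`: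
`factorization_conductorNorm_freyCurve_two_le_one`; `16 ∤ B`: `hDK`).  So `N(ρ̄) ∣ 8`.  Comparing
constant terms of the Frobenius polynomials at the primes `q ∤ 2 p abc`
(`charpoly_baseChange_of_isTorsionGaloisRep`: `X² − a_q X + q`) gives `ε_f(q) q ≡ q`, so
`ε_f(q) = 1` as `p ∤ φ(N(ρ̄)) ∣ 4`
(`nebentypus_apply_eq_one_of_map_coeff_zero_eq_of_not_dvd_totient`), `ε_f = 1` by Dirichlet
(`nebentypus_eq_one_of_forall_prime`), `f` descends to a newform on `Γ₀(N(ρ̄))`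
(`exists_isNewform0_coe_eq_of_nebentypus_eq_one`), and there is none
(`not_isNewform0_of_dvd_eight`: `g(X₀(N)) = 0` for `N ∣ 8`, Manin's bound
`finrank_cuspForm_two_le_genusX0`).
[cite: Ribet1997, Thm. 3 and §3, p. 13] [cite: Serre1987, §4.1 (Prop. 6, (4.1.11), (4.1.12)), §4.2, (4.6.3)]
[cite: KhareWintenberger2009, Thm. 1.2 and Thm. 9.1] -/
theorem ribet1997_twoPowerFermat_of_khare_wintenberger_of_frey_local
    (hKW : ∀ (p : ℕ) [Fact p.Prime] (k : Type) [Field k] [TopologicalSpace k] [DiscreteTopology k],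
      khare_wintenberger p k)
    (hirr : ∀ (A B : ℤ) (p : ℕ), p.Prime → 5 ≤ p → IsCoprime A B → A * B * (A + B) ≠ 0 →
      A ≡ -1 [ZMOD 4] → (2 : ℤ) ∣ B → (freyCurve A B).HasIrreducibleModPGaloisRep p)
    (hwt : ∀ (W : WeierstrassCurve ℚ) [W.IsElliptic] (p : ℕ) [Fact p.Prime], 5 ≤ p →
      W.IsSemistableAt ((primesEquiv (R := ℤ)).symm ⟨p, Fact.out⟩) →
      p ∣ W.ordMinimalDiscriminant ((primesEquiv (R := ℤ)).symm ⟨p, Fact.out⟩) →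
      ∀ ρ : ModPGaloisRep ℚ (ZMod p) 2, W.IsTorsionGaloisRep p ρ →
        ∀ (k : Type) [Field k] [TopologicalSpace k] [DiscreteTopology k] [CharP k p]
          [IsAlgClosed k] (j : ZMod p →+* k)
          (loc : LocalRestrictionAt p (FramedRep.baseChange j continuous_of_discreteTopology ρ))
          (ι : absIntegers 𝒪[loc.F] loc.F ⧸ absMaximalIdeal loc.F →+* k),
          serreWeight p (FramedRep.baseChange j continuous_of_discreteTopology ρ) loc ι = 2)
    (hlevN : ∀ (W : WeierstrassCurve ℚ) [W.IsElliptic] (p : ℕ) [Fact p.Prime],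
      ∀ ρ : ModPGaloisRep ℚ (ZMod p) 2, W.IsTorsionGaloisRep p ρ →
        ∀ (k : Type) [Field k] [TopologicalSpace k] [DiscreteTopology k] [CharP k p]
          [IsAlgClosed k] (j : ZMod p →+* k),
          serreLevel p (FramedRep.baseChange j continuous_of_discreteTopology ρ) ∣
            W.conductorNorm ℤ)
    (hTate : ∀ (W : WeierstrassCurve ℚ) [W.IsElliptic] (p : ℕ) [Fact p.Prime],
      ∀ ρ : ModPGaloisRep ℚ (ZMod p) 2, W.IsTorsionGaloisRep p ρ →
        ∀ (k : Type) [Field k] [TopologicalSpace k] [DiscreteTopology k] [CharP k p]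
          [IsAlgClosed k] (j : ZMod p →+* k) (v : HeightOneSpectrum ℤ),
          natGenerator v ≠ p → W.IsSemistableAt v → p ∣ W.ordMinimalDiscriminant v →
            ¬ natGenerator v ∣ serreLevel p (FramedRep.baseChange j continuous_of_discreteTopology ρ))
    (hDK : ∀ (A B : ℤ), IsCoprime A B → A * B * (A + B) ≠ 0 → A ≡ -1 [ZMOD 4] → (4 : ℤ) ∣ B →
      ¬ (16 : ℤ) ∣ B →
        (freyCurve A B).conductorExponent ((primesEquiv (R := ℤ)).symm ⟨2, Nat.prime_two⟩) ≤ 3) :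
    ribet1997_twoPowerFermat := by
  classical
  rw [ribet1997_twoPowerFermat_iff_normalized]
  intro p hp h5 r h2r hrp a b c h0 hab hac hbc ha heq
  haveI hpF : Fact p.Prime := ⟨hp⟩
  have hodd : Odd p := hp.odd_of_ne_two (by omega)
  have hp2 : p ≠ 2 := by omega
  obtain ⟨hcop, hne, hA, h4, hsum⟩ := Ribet1997.monomials hodd h2r h0 hab hac ha heq
  have hB2 : (2 : ℤ) ∣ 2 ^ r * b ^ p := dvd_trans (by norm_num) h4
  set W : WeierstrassCurve ℚ := freyCurve (a ^ p) (2 ^ r * b ^ p) with hW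
  haveI hWE : W.IsElliptic := isElliptic_freyCurve hne
  /- Step 1. A framed model `ρ̄` of `E[p]` and its extension of scalars `ρ̄' = ρ̄ ⊗ 𝔽̄_p`. -/
  haveI : NeZero ((p : ℕ) : ℚ) := ⟨by exact_mod_cast hp.ne_zero⟩
  obtain ⟨ρ, hρ⟩ := W.exists_isTorsionGaloisRep p
  letI : TopologicalSpace (AlgebraicClosure (ZMod p)) := ⊥
  haveI : DiscreteTopology (AlgebraicClosure (ZMod p)) := ⟨rfl⟩
  set j : ZMod p →+* AlgebraicClosure (ZMod p) := algebraMap (ZMod p) (AlgebraicClosure (ZMod p))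
    with hj
  set ρ' : ModPGaloisRep ℚ (AlgebraicClosure (ZMod p)) 2 :=
    FramedRep.baseChange j continuous_of_discreteTopology ρ with hρ'
  -- `ρ̄'` is irreducible (`hirr`) and odd (`det ρ̄ = χ̄_p`)
  have habs := isAbsolutelyIrreducible_of_hasIrreducibleModPGaloisRep W hp2
    (hirr _ _ p hp h5 hcop hne hA hB2) hρ
  have hirr' : ρ'.toGaloisRep.IsIrreducible := by
    rw [← ModPGaloisRep.isIrreducible_iff_toGaloisRep]
    exact habs.isIrreducible_baseChange (AlgebraicClosure (ZMod p)) j _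
  have hodd' : FramedGaloisRep.IsOdd ρ' :=
    (ModPGaloisRep.isOdd_of_det_eq_modPCyclotomicCharacterZMod ρ
      (W.det_eq_modPCyclotomicCharacter_of_isTorsionGaloisRep_holds p ρ hρ)).baseChange j _
  /- Step 2. Serre's conjecture (Khare–Wintenberger): `ρ̄'` arises from a newform `f` of weight
  `k(ρ̄')` and level `N(ρ̄')`. -/
  obtain ⟨loc⟩ := nonempty_localRestrictionAt p ρ'
  obtain ⟨ι⟩ := nonempty_ringHom_residue (k := AlgebraicClosure (ZMod p)) p loc.F
    loc.residueFieldCard_eq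
  /- Step 3. The weight is `2` (`hwt`): `E` is semistable at `p` and `p ∣ ord_p (Δ_E)`. -/
  set vp : HeightOneSpectrum ℤ := (primesEquiv (R := ℤ)).symm ⟨p, hp⟩ with hvp_def
  have hvp : natGenerator vp = p := Literature.NumberTheory.EllipticCurves.Rat.natGenerator_primesEquiv_symm ⟨p, hp⟩
  have hpord : p ∣ W.ordMinimalDiscriminant vp :=
    (Ribet1997.dvd_ordMinimalDiscriminant_of_ne_two hodd h2r h0 hab hac ha heq vp
      (by rw [hvp]; exact hp2)).2
  have hsemi : W.IsSemistableAt vp :=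
    isSemistableAt_freyCurve_holds (a ^ p) (2 ^ r * b ^ p) hcop hne vp (by rw [hvp]; exact hp2)
  have hw : (serreWeight p ρ' loc ι : ℤ) = 2 := by
    have h2 : serreWeight p ρ' loc ι = 2 :=
      hwt W p h5 hsemi hpord ρ hρ (AlgebraicClosure (ZMod p)) j loc ι
    rw [h2]; rfl
  -- the newform of (3.2.4), transported to weight `2`
  obtain ⟨f, ιf, hf, hgal⟩ := hKW p (AlgebraicClosure (ZMod p)) ρ' hirr' hodd' loc ι
  revert hgal hf ιf f
  rw [hw]
  intro f ιf hf hgal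
  /- Step 4. The level divides `8`. -/
  set N : ℕ := serreLevel p ρ' with hN_def
  have hN0 : N ≠ 0 := by
    intro h0'
    apply not_dvd_serreLevel p ρ'
    rw [← hN_def, h0']
    exact dvd_zero p
  haveI hNz : NeZero N := ⟨hN0⟩
  have hNE : N ∣ W.conductorNorm ℤ := hlevN W p ρ hρ (AlgebraicClosure (ZMod p)) j
  have hN8 : N ∣ 8 := by
    refine dvd_eight_of_forall_prime hN0 hNE (conductorNorm_pos_holds W).ne' ?_ ?_
    · -- odd primes of `N` are excluded by `hTate`
      intro q hq hqN
      by_contra hq2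
      have hqp : q ≠ p := by
        rintro rfl
        exact not_dvd_serreLevel q ρ' (by rw [← hN_def]; exact hqN)
      have hqm : (q : ℤ) ∣ a ^ p * (2 ^ r * b ^ p) * (a ^ p + 2 ^ r * b ^ p) :=
        dvd_of_dvd_conductorNorm_freyCurve hcop hne hq hq2 (hqN.trans hNE)
      set u : HeightOneSpectrum ℤ := (primesEquiv (R := ℤ)).symm ⟨q, hq⟩ with hu_def
      have hu : natGenerator u = q := Literature.NumberTheory.EllipticCurves.Rat.natGenerator_primesEquiv_symm ⟨q, hq⟩
      have hordu : p ∣ W.ordMinimalDiscriminant u :=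
        (Ribet1997.dvd_ordMinimalDiscriminant_of_ne_two hodd h2r h0 hab hac ha heq u
          (by rw [hu]; exact hq2)).2
      have hsemiu : W.IsSemistableAt u :=
        isSemistableAt_freyCurve_holds (a ^ p) (2 ^ r * b ^ p) hcop hne u (by rw [hu]; exact hq2)
      have := hTate W p ρ hρ (AlgebraicClosure (ZMod p)) j u (by rw [hu]; exact hqp) hsemiu hordu
      exact this (by rw [hu]; exact hqN)
    · -- `ord₂ N_E ≤ 3`
      rcases Ribet1997.sixteen_dvd_or_odd (by omega : 4 ≤ p) b (r := r) with h16 | ⟨hbo, hr3⟩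
      · exact (factorization_conductorNorm_freyCurve_two_le_one hcop hne hA h16).trans (by norm_num)
      · rw [show (2 : ℕ) = ((⟨2, Nat.prime_two⟩ : Nat.Primes) : ℕ) from rfl,
          factorization_conductorNorm_primesEquiv_symm]
        refine hDK _ _ hcop hne hA h4 ?_
        -- `16 ∤ 2^r b^p` for `b` odd, `r ≤ 3`
        intro h16
        have hb2 : ¬ (2 : ℤ) ∣ b := Int.two_dvd_ne_zero.mpr (Int.odd_iff.mp hbo)
        have hcop2 : IsCoprime ((2 : ℤ) ^ 4) (b ^ p) :=
          ((Int.prime_two.coprime_iff_not_dvd).2 hb2).pow_left.pow_right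
        have h' : (2 : ℤ) ^ 4 ∣ 2 ^ r := hcop2.dvd_of_dvd_mul_right (by exact_mod_cast h16)
        have h'' : 2 ^ 4 ∣ 2 ^ r := by exact_mod_cast h'
        have := (Nat.pow_dvd_pow_iff_le_right one_lt_two).mp h''
        omega
  /- Step 5. The primes `q > |abc|` are primes of good reduction; conclude by
  `false_of_isGaloisRepOfNewform1Int_of_dvd_eight`. -/
  refine false_of_isGaloisRepOfNewform1Int_of_dvd_eight W h5 hρ j hN8 hf ιf hgal
    (max 2 (a * b * c).natAbs) fun q hq hqB ↦ ?_
  have hq2 : q ≠ 2 := fun h' ↦ (lt_of_le_of_lt (le_max_left _ _) hqB).ne' h'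
  have hqabc : ¬ (q : ℤ) ∣ a * b * c := by
    intro h'
    have hle : q ≤ (a * b * c).natAbs :=
      Nat.le_of_dvd (Int.natAbs_pos.mpr h0) (Int.natCast_dvd.mp h')
    exact (lt_of_le_of_lt (le_max_right _ _) hqB).not_ge hle
  refine not_dvd_conductorNorm_freyCurve_of_not_dvd hcop hne hq hq2 ?_
  -- `q ∤ AB(A+B) = -(a^p)(2^r b^p)(c^p)`
  rw [hsum]
  have hqint : Prime (q : ℤ) := Nat.prime_iff_prime_int.mp hq
  have hp0 : p ≠ 0 := hp.ne_zero
  intro h'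
  apply hqabc
  rcases hqint.dvd_or_dvd h' with h' | h'
  · rcases hqint.dvd_or_dvd h' with h' | h'
    · exact dvd_mul_of_dvd_left (dvd_mul_of_dvd_left (hqint.dvd_of_dvd_pow h') _) _
    · rcases hqint.dvd_or_dvd h' with h' | h'
      · exact absurd (eq_two_of_dvd_sixteen hq ((hqint.dvd_of_dvd_pow h').trans (by norm_num)))
          hq2
      · exact dvd_mul_of_dvd_left (dvd_mul_of_dvd_right (hqint.dvd_of_dvd_pow h') _) _
  · exact dvd_mul_of_dvd_right (hqint.dvd_of_dvd_pow (dvd_neg.mp h')) _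

end SerreRoad

end Literature.NumberTheory.DiophantineGeometry
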